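import Summits.Ventures.HodgeRepro2.T5BergmanMatrixCoeff

/-!
# Strong continuity of the weighted Bergman model

The matrix coefficients `g ↦ ⟨π_k(g) f, h⟩_k` are continuous (`T5BergmanMatrixCoeff.continuous_matrixCoeff`);
with unitarity this gives **strong continuity**: for holomorphic `f ∈ A_k`,

  `‖π_k(g) f - π_k(g₀) f‖_k² = 2 ⟨f, f⟩_k - 2 Re ⟨π_k(g₀⁻¹ g) f, f⟩_k → 0`   as `g → g₀`

(`pairing_act_sub_self`, `tendsto_pairing_act_sub`): the orbit map `g ↦ π_k(g) f` is continuous into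
`A_k` with its norm topology — the model is a (unitary, strongly) continuous representation of `SU(1,1)`.

Blind lane: Mathlib + the HodgeRepro2 prefix only; no sorry; axioms ⊆ {propext, Classical.choice,
Quot.sound}.
-/

namespace Summit.Ventures.HodgeRepro2.T5BergmanStrongContinuity

open MeasureTheory Metric Filter Topology
open T5PoincareDensity T5SU11Unimodular T5SU11Fibration
open T5BergmanCoefficient T5BergmanPairing T5BergmanUnitary T5BergmanFourier T5BergmanParseval
  T5BergmanCoefficientL2 T5BergmanActStable T5BergmanMatrixCoeff

/-- **The norm of `π_k(g) f - π_k(g₀) f`**: `⟨π_k(g) f - π_k(g₀) f, π_k(g) f - π_k(g₀) f⟩_k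
= 2 ⟨f, f⟩_k - 2 Re ⟨π_k(g₀⁻¹ g) f, f⟩_k` for holomorphic `f ∈ A_k`. -/
theorem pairing_act_sub_self (k : ℕ) (hk : 2 ≤ k) (f : ℂ → ℂ) (hf : DifferentiableOn ℂ f (ball 0 1))
    (hfint : IntegrableOn (fun w => ‖f w‖ ^ 2 * (1 - ‖w‖ ^ 2) ^ (k - 2)) (ball (0 : ℂ) 1))
    (g g₀ : SU11) :
    (pairing k (act k g f - act k g₀ f) (act k g f - act k g₀ f)).re =
      2 * (pairing k f f).re - 2 * (matrixCoeff k f f (g₀⁻¹ * g)).re := by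
  have hg : DifferentiableOn ℂ (act k g f) (ball 0 1) := differentiableOn_act k g f hf
  have hg₀ : DifferentiableOn ℂ (act k g₀ f) (ball 0 1) := differentiableOn_act k g₀ f hf
  have hgint := integrableOn_act k hk g f hf hfint
  have hg₀int := integrableOn_act k hk g₀ f hf hfint
  -- expand with the polarisation expansion of `T5BergmanFourier`
  have e : act k g f - act k g₀ f = act k g f + fun z => (-1 : ℂ) * act k g₀ f z := by
    funext z
    simp only [Pi.sub_apply, Pi.add_apply]
    ring
  rw [e, pairing_self_add_const_mul k (-1) hg.continuousOn hg₀.continuousOn hgint hg₀int,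
    pairing_act_act k hk g f f, pairing_act_act k hk g₀ f f]
  -- `⟨π_k(g) f, π_k(g₀) f⟩_k = ⟨π_k(g₀⁻¹ g) f, f⟩_k`
  have hcross : pairing k (act k g f) (act k g₀ f) = matrixCoeff k f f (g₀⁻¹ * g) := by
    unfold matrixCoeff
    rw [pairing_act_mul, ← pairing_act_act k hk g₀ (act k g₀⁻¹ (act k g f)) f]
    refine pairing_congr (fun z hz => ?_) (fun _ _ => rfl)
    rw [← act_mul k g₀ g₀⁻¹ _ hz, mul_inv_cancel, act_one]
  rw [hcross]
  simp only [map_neg, map_one, neg_mul, one_mul, mul_neg, neg_neg, Complex.add_re, Complex.neg_re,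
    Complex.conj_re]
  ring

/-- **Strong continuity**: `‖π_k(g) f - π_k(g₀) f‖_k² → 0` as `g → g₀`, for holomorphic `f ∈ A_k`. -/
theorem tendsto_pairing_act_sub (k : ℕ) (hk : 2 ≤ k) (f : ℂ → ℂ) (hf : DifferentiableOn ℂ f (ball 0 1))
    (hfint : IntegrableOn (fun w => ‖f w‖ ^ 2 * (1 - ‖w‖ ^ 2) ^ (k - 2)) (ball (0 : ℂ) 1)) (g₀ : SU11) :
    Tendsto (fun g => (pairing k (act k g f - act k g₀ f) (act k g f - act k g₀ f)).re) (𝓝 g₀)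
      (𝓝 0) := by
  simp_rw [pairing_act_sub_self k hk f hf hfint _ g₀]
  have hc : Continuous (matrixCoeff k f f) := continuous_matrixCoeff_of_differentiableOn k hk f hf hfint f hf hfint
  have h1 : Tendsto (fun g : SU11 => matrixCoeff k f f (g₀⁻¹ * g)) (𝓝 g₀) (𝓝 (matrixCoeff k f f 1)) := by
    have : Tendsto (fun g : SU11 => g₀⁻¹ * g) (𝓝 g₀) (𝓝 (g₀⁻¹ * g₀)) :=
      (continuous_const.mul continuous_id).tendsto g₀
    rw [inv_mul_cancel] at this
    exact (hc.tendsto _).comp this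
  have h2 : matrixCoeff k f f 1 = pairing k f f := by
    unfold matrixCoeff
    exact pairing_congr (fun z _ => act_one k f z) (fun _ _ => rfl)
  rw [h2] at h1
  have h3 := ((Complex.continuous_re.tendsto _).comp h1).const_mul 2
  have h4 := (tendsto_const_nhds (x := 2 * (pairing k f f).re)).sub h3
  simp only [Function.comp_def, sub_self] at h4
  exact h4

/-- The orbit map is continuous into `A_k` in the form `‖π_k(g) f - π_k(g₀) f‖_k < ε` eventually. -/
theorem eventually_pairing_act_sub_lt (k : ℕ) (hk : 2 ≤ k) (f : ℂ → ℂ)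
    (hf : DifferentiableOn ℂ f (ball 0 1))
    (hfint : IntegrableOn (fun w => ‖f w‖ ^ 2 * (1 - ‖w‖ ^ 2) ^ (k - 2)) (ball (0 : ℂ) 1)) (g₀ : SU11)
    {ε : ℝ} (hε : 0 < ε) :
    ∀ᶠ g in 𝓝 g₀, (pairing k (act k g f - act k g₀ f) (act k g f - act k g₀ f)).re < ε :=
  (tendsto_order.1 (tendsto_pairing_act_sub k hk f hf hfint g₀)).2 ε hε

end Summit.Ventures.HodgeRepro2.T5BergmanStrongContinuity
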